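import Summits.ValiantsHypothesis.ValiantsHypothesis.Theorems.EquivariantDialFiniteLifts
import Mathlib.Algebra.Algebra.Prod
import Mathlib.Algebra.Group.Pointwise.Set.ListOfFn
import Mathlib.LinearAlgebra.FiniteDimensional.Basic
import Mathlib.LinearAlgebra.Matrix.Charpoly.Coeff
import Mathlib.RingTheory.Artinian.Ring
import HarnessLib

/-!
# The intertwiner pair algebra of an affine matrix and its LOCAL case

(decomp-valiant workshop, lens 1 «representation-theoretic obstruction splitting», generation 27, file 1 of 3) —
support file of the census cell `A = EquivariantDialNode.EqHardBiPerm` (item `stmt-ValiantsHypothesis-23702`).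
HONEST SCOPE — five standing sentences: NOT a route, closes NO item.
VP ≠ VNP is NOT proved here and nothing below is progress on it.
The cell A (EqHardBiPerm) itself is NOT proved (neither here nor in files 2–3); 0 S-currency; pure linear algebra.
The series' residual hypothesis
LocalShrinking [status: PAPER; NOT proved in the tree; typed ONLY as a hypothesis: no _holds, no instance, no default argument]
is declared in file 3 only and does not occur in this file.

PURPOSE OF THE SERIES (files 1–3).  After g26 the residual of cell `A` was the finite supplement of the algebraic lift
group (`EquivariantDialFiniteLifts.FiniteLiftSupplement`, Borel–Serre / Brion type, Lean-far).  This series replaces the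
algebraic-group road by ELEMENTARY ALGEBRA: file 1 (this file) = the intertwiner pair algebra `M_A = {(p,q) | p A = A q}`
and its LOCAL case (every element = scalar + nilpotent): the normalised trace is then a character and the trace-zero
part `J` is nilpotent (Artin: the Jacobson radical of the finite-dimensional algebra `M_A` is nilpotent, Mathlib
`IsArtinianRing.isNilpotent_jacobson_bot`); file 2 = finite-group cocycle averaging modulo a nilpotent `φ`-kernel;
file 3 = determinant normalisation ⟹ the exact lifts of a LOCAL window-equivariant representation lie in a FINITE
subgroup (`IsFinEquivariantDetRepr`), hence (g26 `eqHardBiPermFin`) cell `A` follows from the residual `LocalShrinking`.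
WHAT IS PROVED HERE (complete proofs).  §1 `pairLift A γ` (pairs `(p,q)` with `p A = A(γx) q`; the exact lifts of `γ` are
its invertible elements), the grading `pairLift γ · pairLift δ ⊆ pairLift (δγ)`, the unital subalgebra
`pairAlg A = pairLift A 1` of `Mat_s × Mat_s`, unit lifts from `IsEquivariantDetRepr` (the inverse lifting `γ⁻¹`).
§2 `IsLocalRepr A` and, under it (`s ≥ 1`, `char k = 0`): nilpotent ⟺ `pairTrace = 0`; `M_A · nil ⊆ nil`,
`nil · M_A ⊆ nil` (a non-nilpotent element of a local algebra is a unit; `Mat × Mat` is Dedekind-finite); `pairTrace`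
is multiplicative on `M_A`; ★ `(M_A ⊓ ker pairTrace)^N = ⊥` for some `N ≥ 1`.
GRADE (planner's reading; the critic decides): mechanism KNOWN (local finite-dimensional algebras), kernel-NEW glue;
serves files 2–3 only.  References: [cite: LandsbergRessayre2017, §3.3 (the lift group of an equivariant
representation)]; Jacobson radical of an Artinian ring is nilpotent [Mathlib `IsArtinianRing.isNilpotent_jacobson_bot`].
-/

set_option linter.dupNamespace false

namespace Summit.ValiantsHypothesis.ValiantsHypothesis.Theorems.EquivariantDialPairAlgebra

open MvPolynomial Matrix Literature.Computability.AlgebraicComplexity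

noncomputable section

/-! ## §1 Lift spaces and the intertwiner pair algebra -/
section PairAlgebra
variable {k : Type*} [Field k] {σ : Type*} [Fintype σ] [DecidableEq σ] {s : ℕ}

/-- The `k`-space of pairs `(p, q)` with `p · A = A(γ·x) · q`; its invertible elements are exactly the exact lifts
`(g, h)` of `γ` (`A(γ·x) = g A h⁻¹`). -/
def pairLift (A : Matrix (Fin s) (Fin s) (MvPolynomial σ k)) (γ : GL σ k) :
    Submodule k (Matrix (Fin s) (Fin s) k × Matrix (Fin s) (Fin s) k) where
  carrier := {y | y.1.map C * A = Matrix.linSubstEntries γ A * y.2.map C}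
  add_mem' := fun {y z} hy hz => by
    simp only [Set.mem_setOf_eq, Prod.fst_add, Prod.snd_add] at hy hz ⊢
    rw [Matrix.map_add C (map_add C), Matrix.map_add C (map_add C), Matrix.add_mul, Matrix.mul_add, hy, hz]
  zero_mem' := by
    simp only [Set.mem_setOf_eq, Prod.fst_zero, Prod.snd_zero]
    rw [Matrix.map_zero C C_0, Matrix.zero_mul, Matrix.mul_zero]
  smul_mem' := fun c y hy => by
    simp only [Set.mem_setOf_eq, Prod.smul_fst, Prod.smul_snd] at hy ⊢
    have hf : ∀ a : k, C (σ := σ) (c • a) = c • C a := fun a => by rw [smul_eq_mul, C_mul, smul_eq_C_mul]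
    rw [Matrix.map_smul C c hf, Matrix.map_smul C c hf, Matrix.smul_mul, Matrix.mul_smul, hy]

/-- Membership in a lift space (definitional). -/
theorem mem_pairLift {A : Matrix (Fin s) (Fin s) (MvPolynomial σ k)} {γ : GL σ k}
    {y : Matrix (Fin s) (Fin s) k × Matrix (Fin s) (Fin s) k} :
    y ∈ pairLift A γ ↔ y.1.map C * A = Matrix.linSubstEntries γ A * y.2.map C := Iff.rfl

/-- **THE INTERTWINER PAIR ALGEBRA `M_A`**: pairs `(p, q)` of `s × s` scalar matrices with `p · A = A · q`, a unital
`k`-subalgebra of `Mat_s(k) × Mat_s(k)`; its unit group is the stabiliser `{(g,h) | g A h⁻¹ = A}`. -/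
def pairAlg (A : Matrix (Fin s) (Fin s) (MvPolynomial σ k)) :
    Subalgebra k (Matrix (Fin s) (Fin s) k × Matrix (Fin s) (Fin s) k) where
  carrier := {y | y.1.map C * A = A * y.2.map C}
  mul_mem' := fun {y z} hy hz => by
    simp only [Set.mem_setOf_eq, Prod.fst_mul, Prod.snd_mul] at hy hz ⊢
    rw [Matrix.map_mul, Matrix.map_mul, Matrix.mul_assoc, hz, ← Matrix.mul_assoc, hy, Matrix.mul_assoc]
  one_mem' := by
    simp only [Set.mem_setOf_eq, Prod.fst_one, Prod.snd_one]
    rw [Matrix.map_one C C_0 C_1, Matrix.one_mul, Matrix.mul_one]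
  add_mem' := fun {y z} hy hz => by
    simp only [Set.mem_setOf_eq, Prod.fst_add, Prod.snd_add] at hy hz ⊢
    rw [Matrix.map_add C (map_add C), Matrix.map_add C (map_add C), Matrix.add_mul, Matrix.mul_add, hy, hz]
  zero_mem' := by
    simp only [Set.mem_setOf_eq, Prod.fst_zero, Prod.snd_zero]
    rw [Matrix.map_zero C C_0, Matrix.zero_mul, Matrix.mul_zero]
  algebraMap_mem' := fun r => by
    simp only [Set.mem_setOf_eq]
    have hf : ∀ a : k, C (σ := σ) (r • a) = r • C a := fun a => by rw [smul_eq_mul, C_mul, smul_eq_C_mul]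
    rw [Algebra.algebraMap_eq_smul_one, Prod.smul_fst, Prod.smul_snd, Prod.fst_one, Prod.snd_one,
      Matrix.map_smul C r hf, Matrix.map_one C C_0 C_1, Matrix.smul_mul, Matrix.mul_smul, Matrix.one_mul,
      Matrix.mul_one]

omit [Fintype σ] [DecidableEq σ] in
/-- Membership in the pair algebra (definitional). -/
theorem mem_pairAlg {A : Matrix (Fin s) (Fin s) (MvPolynomial σ k)}
    {y : Matrix (Fin s) (Fin s) k × Matrix (Fin s) (Fin s) k} :
    y ∈ pairAlg A ↔ y.1.map C * A = A * y.2.map C := Iff.rfl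

/-- `M_A` is the lift space of the identity substitution. -/
theorem mem_pairLift_one {A : Matrix (Fin s) (Fin s) (MvPolynomial σ k)}
    {y : Matrix (Fin s) (Fin s) k × Matrix (Fin s) (Fin s) k} : y ∈ pairLift A 1 ↔ y ∈ pairAlg A := by
  rw [mem_pairLift, Matrix.linSubstEntries_one, mem_pairAlg]

/-- … as an equality of `k`-subspaces. -/
theorem toSubmodule_pairAlg (A : Matrix (Fin s) (Fin s) (MvPolynomial σ k)) :
    Subalgebra.toSubmodule (pairAlg A) = pairLift A 1 :=
  Submodule.ext fun _ => by rw [Subalgebra.mem_toSubmodule, mem_pairLift_one]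

/-- **GRADING.**  `pairLift γ · pairLift δ ⊆ pairLift (δ γ)` (the substitution action is a left action on
polynomials, so lift classes compose contravariantly). -/
theorem mul_mem_pairLift {A : Matrix (Fin s) (Fin s) (MvPolynomial σ k)} {γ δ : GL σ k}
    {y z : Matrix (Fin s) (Fin s) k × Matrix (Fin s) (Fin s) k} (hy : y ∈ pairLift A γ) (hz : z ∈ pairLift A δ) :
    y * z ∈ pairLift A (δ * γ) := by
  rw [mem_pairLift] at hy hz ⊢
  have hyδ : y.1.map C * Matrix.linSubstEntries δ A = Matrix.linSubstEntries (δ * γ) A * y.2.map C := by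
    have e := congrArg (Matrix.linSubstEntries δ) hy
    rwa [Matrix.linSubstEntries_mul, Matrix.linSubstEntries_mul, Matrix.linSubstEntries_map_C,
      Matrix.linSubstEntries_map_C, Matrix.linSubstEntries_linSubstEntries] at e
  rw [Prod.fst_mul, Prod.snd_mul, Matrix.map_mul, Matrix.map_mul, Matrix.mul_assoc, hz, ← Matrix.mul_assoc, hyδ,
    Matrix.mul_assoc]

/-- **UNIT LIFTS.**  An exact lift `A(γ·x) = g A h⁻¹` is a UNIT `(g, h)` of `Mat × Mat` lying in `pairLift A γ`, whose
inverse `(g⁻¹, h⁻¹)` lies in `pairLift A γ⁻¹`. -/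
theorem exists_unit_mem_pairLift {Γ : Subgroup (GL σ k)} {f : MvPolynomial σ k}
    {A : Matrix (Fin s) (Fin s) (MvPolynomial σ k)} (hA : IsEquivariantDetRepr Γ f A) {γ : GL σ k} (hγ : γ ∈ Γ) :
    ∃ x : (Matrix (Fin s) (Fin s) k × Matrix (Fin s) (Fin s) k)ˣ,
      (x : Matrix (Fin s) (Fin s) k × Matrix (Fin s) (Fin s) k) ∈ pairLift A γ ∧
      ((x⁻¹ : (Matrix (Fin s) (Fin s) k × Matrix (Fin s) (Fin s) k)ˣ) :
        Matrix (Fin s) (Fin s) k × Matrix (Fin s) (Fin s) k) ∈ pairLift A γ⁻¹ := by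
  obtain ⟨g, h, hgh⟩ := hA.2 γ hγ
  refine ⟨MulEquiv.prodUnits.symm (g, h), ?_, ?_⟩
  · show (g : Matrix (Fin s) (Fin s) k).map C * A =
      Matrix.linSubstEntries γ A * ((h : GL (Fin s) k) : Matrix (Fin s) (Fin s) k).map C
    rw [hgh, Matrix.mul_assoc, Matrix.mul_assoc, ← Matrix.map_mul, ← Units.val_mul, inv_mul_cancel, Units.val_one,
      Matrix.map_one C C_0 C_1, Matrix.mul_one]
  · show ((g⁻¹ : GL (Fin s) k) : Matrix (Fin s) (Fin s) k).map C * A =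
      Matrix.linSubstEntries γ⁻¹ A * ((h⁻¹ : GL (Fin s) k) : Matrix (Fin s) (Fin s) k).map C
    have e := congrArg (Matrix.linSubstEntries γ⁻¹) hgh
    rw [Matrix.linSubstEntries_inv_linSubstEntries, Matrix.linSubstEntries_mul, Matrix.linSubstEntries_mul,
      Matrix.linSubstEntries_map_C, Matrix.linSubstEntries_map_C] at e
    have e2 := congrArg (HMul.hMul ((((g⁻¹ : GL (Fin s) k) : Matrix (Fin s) (Fin s) k).map C :
      Matrix (Fin s) (Fin s) (MvPolynomial σ k)))) e
    rw [Matrix.mul_assoc, inv_map_C_mul_cancel_left] at e2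
    exact e2

end PairAlgebra

/-! ## §2 Local representations: trace character and the nilpotent ideal -/
section Local
variable {k : Type*} [Field k] {σ : Type*} [Fintype σ] [DecidableEq σ] {s : ℕ}

/-- **`IsLocalRepr A`**: every element of the intertwiner pair algebra `M_A` is a scalar plus a nilpotent
(equivalently: `M_A` has no idempotents besides `0, 1`, i.e. the representation is INDECOMPOSABLE under two-sided
constant equivalence). -/
def IsLocalRepr (A : Matrix (Fin s) (Fin s) (MvPolynomial σ k)) : Prop :=
  ∀ y ∈ pairAlg A, ∃ μ : k, IsNilpotent (y - algebraMap k (Matrix (Fin s) (Fin s) k × Matrix (Fin s) (Fin s) k) μ)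

/-- The normalised trace of the first component, `(p, q) ↦ tr p / s` — under `IsLocalRepr` the residue character
`M_A → k`. -/
def pairTrace (s : ℕ) (k : Type*) [Field k] : (Matrix (Fin s) (Fin s) k × Matrix (Fin s) (Fin s) k) →ₗ[k] k :=
  (s : k)⁻¹ • ((Matrix.traceLinearMap (Fin s) k k).comp
    (LinearMap.fst k (Matrix (Fin s) (Fin s) k) (Matrix (Fin s) (Fin s) k)))

/-- `pairTrace (p, q) = s⁻¹ · tr p` (definitional). -/
theorem pairTrace_apply (y : Matrix (Fin s) (Fin s) k × Matrix (Fin s) (Fin s) k) :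
    pairTrace s k y = (s : k)⁻¹ * y.1.trace := rfl

/-- `pairTrace 1 = 1` (`s ≥ 1`, characteristic `0`). -/
theorem pairTrace_one [CharZero k] (hs : 0 < s) :
    pairTrace s k (1 : Matrix (Fin s) (Fin s) k × Matrix (Fin s) (Fin s) k) = 1 := by
  rw [pairTrace_apply, Prod.fst_one, Matrix.trace_one, Fintype.card_fin]
  exact inv_mul_cancel₀ (Nat.cast_ne_zero.mpr hs.ne')

/-- `pairTrace (μ · 1) = μ`. -/
theorem pairTrace_algebraMap [CharZero k] (hs : 0 < s) (μ : k) :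
    pairTrace s k (algebraMap k (Matrix (Fin s) (Fin s) k × Matrix (Fin s) (Fin s) k) μ) = μ := by
  rw [Algebra.algebraMap_eq_smul_one, map_smul, pairTrace_one hs, smul_eq_mul, mul_one]

/-- A nilpotent pair has `pairTrace = 0` (the trace of a nilpotent matrix over a field vanishes). -/
theorem pairTrace_eq_zero_of_isNilpotent {y : Matrix (Fin s) (Fin s) k × Matrix (Fin s) (Fin s) k}
    (hy : IsNilpotent y) : pairTrace s k y = 0 := by
  have h1 : IsNilpotent y.1 := by
    obtain ⟨n, hn⟩ := hy
    exact ⟨n, by rw [← Prod.pow_fst, hn, Prod.fst_zero]⟩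
  rw [pairTrace_apply, (Matrix.isNilpotent_trace_of_isNilpotent h1).eq_zero, mul_zero]

/-- `Mat_s × Mat_s` is Dedekind-finite: a one-sided inverse is two-sided. -/
theorem pair_mul_eq_one_comm {y z : Matrix (Fin s) (Fin s) k × Matrix (Fin s) (Fin s) k} (h : y * z = 1) :
    z * y = 1 := by
  have h1 : y.1 * z.1 = 1 := by rw [← Prod.fst_mul, h, Prod.fst_one]
  have h2 : y.2 * z.2 = 1 := by rw [← Prod.snd_mul, h, Prod.snd_one]
  exact Prod.ext (by rw [Prod.fst_mul, Prod.fst_one]; exact mul_eq_one_comm.mp h1)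
    (by rw [Prod.snd_mul, Prod.snd_one]; exact mul_eq_one_comm.mp h2)

omit [Fintype σ] [DecidableEq σ] in
/-- Under `IsLocalRepr`, an element of `M_A` is nilpotent iff its normalised trace vanishes. -/
theorem IsLocalRepr.isNilpotent_iff [CharZero k] {A : Matrix (Fin s) (Fin s) (MvPolynomial σ k)}
    (hloc : IsLocalRepr A) (hs : 0 < s) {y : Matrix (Fin s) (Fin s) k × Matrix (Fin s) (Fin s) k}
    (hy : y ∈ pairAlg A) : IsNilpotent y ↔ pairTrace s k y = 0 := by
  refine ⟨pairTrace_eq_zero_of_isNilpotent, fun h0 => ?_⟩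
  obtain ⟨μ, hμ⟩ := hloc y hy
  have hμ0 : μ = 0 := by
    have e := pairTrace_eq_zero_of_isNilpotent hμ
    rwa [map_sub, h0, pairTrace_algebraMap hs, zero_sub, neg_eq_zero] at e
  rwa [hμ0, map_zero, sub_zero] at hμ

omit [Fintype σ] [DecidableEq σ] in
/-- Under `IsLocalRepr` (`s ≥ 1`): `M_A · nil ⊆ nil` — a product `y z` with `z` nilpotent is nilpotent (otherwise it
is a unit of the local algebra, so `z` has a one-sided, hence two-sided, inverse: absurd). -/
theorem IsLocalRepr.isNilpotent_mul_of_right [CharZero k] {A : Matrix (Fin s) (Fin s) (MvPolynomial σ k)}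
    (hloc : IsLocalRepr A) (hs : 0 < s) {y z : Matrix (Fin s) (Fin s) k × Matrix (Fin s) (Fin s) k}
    (hy : y ∈ pairAlg A) (hz : z ∈ pairAlg A) (hn : IsNilpotent z) : IsNilpotent (y * z) := by
  have h01 : (0 : Matrix (Fin s) (Fin s) k × Matrix (Fin s) (Fin s) k) ≠ 1 := fun h => by
    have e := congrArg (fun w : Matrix (Fin s) (Fin s) k × Matrix (Fin s) (Fin s) k => w.1 ⟨0, hs⟩ ⟨0, hs⟩) h
    simp at e
  haveI : Nontrivial (Matrix (Fin s) (Fin s) k × Matrix (Fin s) (Fin s) k) := ⟨⟨0, 1, h01⟩⟩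
  by_contra hyz
  obtain ⟨μ, hμ⟩ := hloc (y * z) (mul_mem hy hz)
  have hμ0 : μ ≠ 0 := by
    rintro rfl
    exact hyz (by rwa [map_zero, sub_zero] at hμ)
  have hu : IsUnit (y * z) := by
    have e := hμ.isUnit_add_left_of_commute ((Ne.isUnit hμ0).map (algebraMap k _))
      (Algebra.commute_algebraMap_right μ _)
    rwa [add_sub_cancel] at e
  obtain ⟨w, hw⟩ := hu
  have hleft : ((w⁻¹ : (Matrix (Fin s) (Fin s) k × Matrix (Fin s) (Fin s) k)ˣ) :
      Matrix (Fin s) (Fin s) k × Matrix (Fin s) (Fin s) k) * y * z = 1 := by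
    rw [mul_assoc, ← hw, Units.inv_mul]
  have hright := pair_mul_eq_one_comm hleft
  exact hn.not_isUnit ⟨⟨z, _, hright, hleft⟩, rfl⟩

omit [Fintype σ] [DecidableEq σ] in
/-- Under `IsLocalRepr` (`s ≥ 1`): `nil · M_A ⊆ nil`. -/
theorem IsLocalRepr.isNilpotent_mul_of_left [CharZero k] {A : Matrix (Fin s) (Fin s) (MvPolynomial σ k)}
    (hloc : IsLocalRepr A) (hs : 0 < s) {y z : Matrix (Fin s) (Fin s) k × Matrix (Fin s) (Fin s) k}
    (hy : y ∈ pairAlg A) (hz : z ∈ pairAlg A) (hn : IsNilpotent y) : IsNilpotent (y * z) := by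
  have h01 : (0 : Matrix (Fin s) (Fin s) k × Matrix (Fin s) (Fin s) k) ≠ 1 := fun h => by
    have e := congrArg (fun w : Matrix (Fin s) (Fin s) k × Matrix (Fin s) (Fin s) k => w.1 ⟨0, hs⟩ ⟨0, hs⟩) h
    simp at e
  haveI : Nontrivial (Matrix (Fin s) (Fin s) k × Matrix (Fin s) (Fin s) k) := ⟨⟨0, 1, h01⟩⟩
  by_contra hyz
  obtain ⟨μ, hμ⟩ := hloc (y * z) (mul_mem hy hz)
  have hμ0 : μ ≠ 0 := by
    rintro rfl
    exact hyz (by rwa [map_zero, sub_zero] at hμ)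
  have hu : IsUnit (y * z) := by
    have e := hμ.isUnit_add_left_of_commute ((Ne.isUnit hμ0).map (algebraMap k _))
      (Algebra.commute_algebraMap_right μ _)
    rwa [add_sub_cancel] at e
  obtain ⟨w, hw⟩ := hu
  have hright : y * (z * ((w⁻¹ : (Matrix (Fin s) (Fin s) k × Matrix (Fin s) (Fin s) k)ˣ) :
      Matrix (Fin s) (Fin s) k × Matrix (Fin s) (Fin s) k)) = 1 := by
    rw [← mul_assoc, ← hw, Units.mul_inv]
  have hleft := pair_mul_eq_one_comm hright
  exact hn.not_isUnit ⟨⟨y, _, hright, hleft⟩, rfl⟩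

omit [Fintype σ] [DecidableEq σ] in
/-- **THE TRACE CHARACTER.**  Under `IsLocalRepr` (`s ≥ 1`), `pairTrace` is multiplicative on `M_A`. -/
theorem IsLocalRepr.pairTrace_mul [CharZero k] {A : Matrix (Fin s) (Fin s) (MvPolynomial σ k)}
    (hloc : IsLocalRepr A) (hs : 0 < s) {y z : Matrix (Fin s) (Fin s) k × Matrix (Fin s) (Fin s) k}
    (hy : y ∈ pairAlg A) (hz : z ∈ pairAlg A) : pairTrace s k (y * z) = pairTrace s k y * pairTrace s k z := by
  obtain ⟨μ, hμ⟩ := hloc y hy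
  have hnM : y - algebraMap k _ μ ∈ pairAlg A := sub_mem hy (Subalgebra.algebraMap_mem _ μ)
  have hn0 : pairTrace s k (y - algebraMap k _ μ) = 0 := pairTrace_eq_zero_of_isNilpotent hμ
  have hnz : pairTrace s k ((y - algebraMap k _ μ) * z) = 0 :=
    pairTrace_eq_zero_of_isNilpotent (hloc.isNilpotent_mul_of_left hs hnM hz hμ)
  have hyμ : pairTrace s k y = μ := by
    rw [map_sub, pairTrace_algebraMap hs, sub_eq_zero] at hn0
    exact hn0
  have e : y * z = μ • z + (y - algebraMap k _ μ) * z := by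
    rw [sub_mul, Algebra.algebraMap_eq_smul_one, smul_mul_assoc, one_mul, add_sub_cancel]
  rw [e, map_add, map_smul, hnz, add_zero, smul_eq_mul, hyμ]

/-- A product of `n` elements of a left ideal lies in its `n`-th power. -/
theorem list_prod_mem_pow {R : Type*} [Ring R] (I : Ideal R) :
    ∀ (n : ℕ) (f : Fin n → R), (∀ i, f i ∈ I) → (List.ofFn f).prod ∈ I ^ n
  | 0, _, _ => by
    rw [List.ofFn_zero, List.prod_nil, Submodule.pow_zero, Ideal.one_eq_top]
    exact Submodule.mem_top
  | n + 1, f, hf => by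
    rw [List.ofFn_succ', List.concat_eq_append, List.prod_append, List.prod_singleton, Submodule.pow_succ]
    exact Submodule.mul_mem_mul (list_prod_mem_pow I n _ fun i => hf _) (hf _)

omit [Fintype σ] [DecidableEq σ] in
/-- ★ **NILPOTENCY OF THE TRACE-ZERO IDEAL.**  Under `IsLocalRepr` (`s ≥ 1`) some power of the `k`-subspace
`J = M_A ⊓ ker pairTrace` (= the nilpotent elements of `M_A`, a two-sided ideal) vanishes: `J^N = ⊥`, `N ≥ 1`
(Artin: `J` lies in the Jacobson radical of the finite-dimensional algebra `M_A`, which is nilpotent). -/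
theorem IsLocalRepr.exists_pow_eq_bot [CharZero k] {A : Matrix (Fin s) (Fin s) (MvPolynomial σ k)}
    (hloc : IsLocalRepr A) (hs : 0 < s) : ∃ N : ℕ, 0 < N ∧
      (Subalgebra.toSubmodule (pairAlg A) ⊓ LinearMap.ker (pairTrace s k)) ^ N = ⊥ := by
  haveI : IsArtinianRing (pairAlg A) := IsArtinianRing.of_finite k (pairAlg A)
  -- the left ideal of trace-zero (= nilpotent) elements of the ring `M_A`
  let JR : Ideal (pairAlg A) :=
    { carrier := {r | pairTrace s k (r : Matrix (Fin s) (Fin s) k × Matrix (Fin s) (Fin s) k) = 0}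
      add_mem' := fun {a b} ha hb => by
        simp only [Set.mem_setOf_eq, Subalgebra.coe_add, map_add] at ha hb ⊢
        rw [ha, hb, add_zero]
      zero_mem' := by simp only [Set.mem_setOf_eq, Subalgebra.coe_zero, map_zero]
      smul_mem' := fun c r hr => by
        simp only [Set.mem_setOf_eq, smul_eq_mul, Subalgebra.coe_mul] at hr ⊢
        exact (hloc.isNilpotent_iff hs (mul_mem c.2 r.2)).mp
          (hloc.isNilpotent_mul_of_right hs c.2 r.2 ((hloc.isNilpotent_iff hs r.2).mpr hr)) }
  have hmemJR : ∀ {r : pairAlg A}, r ∈ JR ↔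
      pairTrace s k (r : Matrix (Fin s) (Fin s) k × Matrix (Fin s) (Fin s) k) = 0 := Iff.rfl
  -- its elements are nilpotent in the ring `M_A`
  have hnilJR : ∀ r ∈ JR, IsNilpotent r := fun r hr => by
    obtain ⟨n, hn⟩ := (hloc.isNilpotent_iff hs r.2).mpr (hmemJR.mp hr)
    exact ⟨n, Subtype.ext (by rw [Subalgebra.coe_pow, hn, Subalgebra.coe_zero])⟩
  -- hence it lies in the Jacobson radical, which is nilpotent (Artin)
  have hJR : JR ≤ Ideal.jacobson ⊥ := fun x hx => Ideal.mem_jacobson_iff.mpr fun y => by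
    obtain ⟨u, hu⟩ := (hnilJR _ (JR.smul_mem y hx)).isUnit_add_one
    refine ⟨↑u⁻¹, ?_⟩
    rw [Ideal.mem_bot, mul_assoc, ← mul_add_one, ← smul_eq_mul y x, ← hu, Units.inv_mul, sub_self]
  obtain ⟨N, hN⟩ := IsArtinianRing.isNilpotent_jacobson_bot (R := pairAlg A)
  refine ⟨N + 1, Nat.succ_pos N, ?_⟩
  have hpow : (Subalgebra.toSubmodule (pairAlg A) ⊓ LinearMap.ker (pairTrace s k)) ^ N = ⊥ := by
    rw [Submodule.pow_eq_span_pow_set, Submodule.span_eq_bot]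
    intro z hz
    obtain ⟨g, rfl⟩ := Set.mem_pow.mp hz
    have hg : ∀ i, (g i : Matrix (Fin s) (Fin s) k × Matrix (Fin s) (Fin s) k) ∈ pairAlg A ∧
        pairTrace s k (g i : Matrix (Fin s) (Fin s) k × Matrix (Fin s) (Fin s) k) = 0 := fun i => by
      have h := (g i).2
      rw [SetLike.mem_coe, Submodule.mem_inf, Subalgebra.mem_toSubmodule, LinearMap.mem_ker] at h
      exact h
    let f : Fin N → pairAlg A := fun i => ⟨g i, (hg i).1⟩
    have hf : (List.ofFn f).prod ∈ (Ideal.jacobson ⊥ : Ideal (pairAlg A)) ^ N :=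
      list_prod_mem_pow _ N f fun i => hJR (hmemJR.mpr (hg i).2)
    rw [hN, Submodule.zero_eq_bot, Ideal.mem_bot] at hf
    have e := congrArg (fun r : pairAlg A => (r : Matrix (Fin s) (Fin s) k × Matrix (Fin s) (Fin s) k)) hf
    simp only [Subalgebra.coe_zero, SubmonoidClass.coe_list_prod, List.map_ofFn] at e
    exact e
  rw [Submodule.pow_succ, hpow, Submodule.bot_mul]

end Local

end

end Summit.ValiantsHypothesis.ValiantsHypothesis.Theorems.EquivariantDialPairAlgebra
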